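import Mathlib.Algebra.Polynomial.Roots
import Literature.Computability.AlgebraicComplexity.Polystability
import HarnessLib

/-!
# Diagonal one-parameter subgroups acting on polynomials: weights and limits

Plumbing for the Hilbert–Mumford criterion for `SL_σ(k)` acting on polynomials by linear
substitution of variables (`linSubst`, `LinSubst.lean`; companion theorem file
`HilbertMumfordSLForms.lean`). For an integer weight vector `a : σ → ℤ` the diagonal
one-parameter subgroup `λ_a(t) = diag(t^{a_i})` of `GL_σ` (of `SL_σ` when `∑ a_i = 0`) acts on the
monomial `x^d` by the character `t ↦ t^{⟨a,d⟩}`, `⟨a,d⟩ = ∑_i a_i d_i` (Mumford–Fogarty–Kirwan, GIT,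
Ch. 2 §1, proof of Thm. 2.1: "Suppose `λ(α)` acts via the matrix `(α^{r_i} δ_{ij})`"; Kempf 1978 §1;
Bürgisser–Ikenmeyer 2017 §2.2: "`σ(t) w = ∑_α t^{⟨α,μ⟩} w_α X^α`"). The limit `lim_{t → 0} λ_a(t)·p`
exists iff every monomial of `p` has weight `≥ 0`, and then equals the weight-zero part of `p`.

Definitions (two, with unfolding lemmas): `diagWeight a d = ⟨a,d⟩` and `diagLimit a p` = the
weight-zero part of `p`. Theorems: the coefficient formula for diagonal substitutions
(`coeff_linSubst_diagonal_eq_prod_mul`, `coeff_linSubst_diagonal_zpow`), `det diag(t^a) = 1` when `∑ a = 0`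
(`det_diagonal_zpow_eq_one`), and the ALGEBRAIC LIMIT LEMMA over an infinite field: a Zariski
closed set containing the punctured polynomial curve `t ↦ (y_i t^{e_i})_i`, `t ≠ 0`, contains its
value at `t = 0` (`mem_of_forall_ne_zero_mul_pow_mem`; a polynomial in one variable with infinitely
many roots vanishes), whence a Zariski closed set containing all `diag(t^a)·p`, `t ≠ 0`, for a `p`
with non-negative weights contains the limit `diagLimit a p` (`coeffVec_diagLimit_mem`). No named
facts. Honest framing: textbook GIT bookkeeping (cell `val-lit`, seat t14 g7); nothing here bears
on `VP` versus `VNP`.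

## References

* [MumfordFogartyKirwan1994] D. Mumford, J. Fogarty, F. Kirwan, *Geometric Invariant Theory*,
  3rd ed., Springer 1994, Ch. 2 §1 (held text `book:mumford1994-geometric-invariant-theory`,
  pp. 59–61 = p0059–p0061).
* [Kempf1978] G. Kempf, *Instability in invariant theory*, Ann. of Math. 108 (1978) 299–316, §1.
* [BurgisserIkenmeyer2017] P. Bürgisser, C. Ikenmeyer, *Fundamental invariants of orbit closures*,
  J. Algebra 477 (2017), §2.2 (proof of Prop. 2.8).
-/

noncomputable section

open MvPolynomial

namespace Literature.Computability.AlgebraicComplexity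

/-! ### Weights of monomials under a diagonal one-parameter subgroup -/

section Weight

variable {σ : Type*} [Fintype σ]

/-- The weight `⟨a, d⟩ = ∑_i a_i d_i` of the monomial `x^d` under the diagonal one-parameter
subgroup `t ↦ diag(t^{a_i})`: `diag(t^a) · x^d = t^{⟨a,d⟩} x^d` (GIT Ch. 2 §1, the exponents `r_i`
of the proof of Thm. 2.1; BI 2017 §2.2 "`⟨α, μ⟩ := ∑_i α_i μ_i`").
[cite: MumfordFogartyKirwan1994, Ch. 2 §1 (proof of Thm. 2.1, p. 60)]
[cite: BurgisserIkenmeyer2017, §2.2 (proof of Prop. 2.8)] -/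
def diagWeight (a : σ → ℤ) (d : σ →₀ ℕ) : ℤ :=
  ∑ i, a i * (d i : ℤ)

/-- Unfolding `diagWeight`. [cite: MumfordFogartyKirwan1994, Ch. 2 §1 (proof of Thm. 2.1)] -/
theorem diagWeight_apply (a : σ → ℤ) (d : σ →₀ ℕ) : diagWeight a d = ∑ i, a i * (d i : ℤ) := rfl

/-- The weight of `x^d` under `diag(t^{-a})` is minus its weight under `diag(t^a)` (the inverse one-parameter subgroup). [cite: MumfordFogartyKirwan1994, Ch. 2 §1 (proof of Thm. 2.1)] -/
theorem diagWeight_neg (a : σ → ℤ) (d : σ →₀ ℕ) : diagWeight (-a) d = -diagWeight a d := by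
  simp only [diagWeight, Pi.neg_apply, neg_mul, Finset.sum_neg_distrib]

/-- The constant monomial has weight `0`. [cite: MumfordFogartyKirwan1994, Ch. 2 §1 (proof of Thm. 2.1)] -/
theorem diagWeight_zero_right (a : σ → ℤ) : diagWeight a 0 = 0 := by
  simp [diagWeight]

/-- The trivial one-parameter subgroup gives weight `0`. [cite: MumfordFogartyKirwan1994, Ch. 2 §1 (proof of Thm. 2.1)] -/
theorem diagWeight_zero_left (d : σ →₀ ℕ) : diagWeight (0 : σ → ℤ) d = 0 := by
  simp [diagWeight]

end Weight

/-! ### The limit `lim_{t → 0} diag(t^a) · p`: the weight-zero part -/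

section Limit

variable {σ : Type*} [Fintype σ] {k : Type*} [CommRing k]

/-- The **limit** `lim_{t→0} diag(t^{a}) · p` of a polynomial all of whose monomials have weight
`⟨a,d⟩ ≥ 0`: its weight-zero part `∑_{⟨a,d⟩ = 0} p_d x^d` (GIT Ch. 2 §1: the specialization of
`σ(λ(α), x)` as `α → 0` keeps exactly the coordinates with `r_i = 0`; Kempf 1978 §1). Defined for
every `p`; it is the limit only under the sign condition on the support.
[cite: MumfordFogartyKirwan1994, Ch. 2 §1 (proof of Thm. 2.1, p. 60–61)] [cite: Kempf1978, §1] -/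
def diagLimit (a : σ → ℤ) (p : MvPolynomial σ k) : MvPolynomial σ k :=
  ∑ d ∈ p.support with diagWeight a d = 0, monomial d (coeff d p)

/-- Coefficients of the limit: those of `p` in weight `0`, zero elsewhere.
[cite: MumfordFogartyKirwan1994, Ch. 2 §1 (proof of Thm. 2.1)] -/
theorem coeff_diagLimit [DecidableEq σ] (a : σ → ℤ) (p : MvPolynomial σ k) (d : σ →₀ ℕ) :
    coeff d (diagLimit a p) = if diagWeight a d = 0 then coeff d p else 0 := by
  classical
  rw [diagLimit, coeff_sum]
  simp only [coeff_monomial]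
  rw [Finset.sum_ite_eq']
  simp only [Finset.mem_filter, mem_support_iff]
  by_cases h0 : diagWeight a d = 0
  · rw [if_pos h0]
    by_cases hc : coeff d p = 0
    · rw [if_neg (fun h => h.1 hc), hc]
    · rw [if_pos ⟨hc, h0⟩]
  · rw [if_neg h0, if_neg (fun h => h0 h.2)]

/-- The support of the limit lies in the support of `p`. [cite: MumfordFogartyKirwan1994, Ch. 2 §1 (proof of Thm. 2.1)] -/
theorem support_diagLimit_subset [DecidableEq σ] (a : σ → ℤ) (p : MvPolynomial σ k) :
    (diagLimit a p).support ⊆ p.support := by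
  intro d hd
  rw [mem_support_iff, coeff_diagLimit] at hd
  rw [mem_support_iff]
  split_ifs at hd with h
  · exact hd
  · exact absurd rfl hd

/-- Every monomial of the limit has weight `0` (the limit is fixed by the one-parameter subgroup). [cite: MumfordFogartyKirwan1994, Ch. 2 §1 (proof of Thm. 2.1)] -/
theorem diagWeight_eq_zero_of_mem_support_diagLimit [DecidableEq σ] (a : σ → ℤ)
    (p : MvPolynomial σ k) {d : σ →₀ ℕ} (hd : d ∈ (diagLimit a p).support) :
    diagWeight a d = 0 := by
  rw [mem_support_iff, coeff_diagLimit] at hd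
  by_contra h
  exact hd (if_neg h)

/-- The limit for the trivial one-parameter subgroup is `p` itself. [cite: MumfordFogartyKirwan1994, Ch. 2 §1 (proof of Thm. 2.1)] -/
theorem diagLimit_zero [DecidableEq σ] (p : MvPolynomial σ k) : diagLimit (0 : σ → ℤ) p = p := by
  refine MvPolynomial.ext _ _ fun d => ?_
  rw [coeff_diagLimit, diagWeight_zero_left, if_pos rfl]

/-- Two polynomials with the same weight-zero coefficients have the same limit. [cite: MumfordFogartyKirwan1994, Ch. 2 §1 (proof of Thm. 2.1)] -/
theorem diagLimit_congr [DecidableEq σ] (a : σ → ℤ) {p q : MvPolynomial σ k}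
    (h : ∀ d, diagWeight a d = 0 → coeff d p = coeff d q) : diagLimit a p = diagLimit a q := by
  refine MvPolynomial.ext _ _ fun d => ?_
  rw [coeff_diagLimit, coeff_diagLimit]
  split_ifs with hd
  · exact h d hd
  · rfl

/-- The limit for `-a` equals the limit for `a` (same weight-zero part). [cite: MumfordFogartyKirwan1994, Ch. 2 §1 (proof of Thm. 2.1)] -/
theorem diagLimit_neg [DecidableEq σ] (a : σ → ℤ) (p : MvPolynomial σ k) :
    diagLimit (-a) p = diagLimit a p := by
  refine MvPolynomial.ext _ _ fun d => ?_
  simp only [coeff_diagLimit, diagWeight_neg, neg_eq_zero]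

end Limit

section LimitField

variable {σ : Type*} [Fintype σ] [DecidableEq σ] {k : Type*} [Field k]

/-- The coefficient vector of the limit. [cite: MumfordFogartyKirwan1994, Ch. 2 §1 (proof of Thm. 2.1)] -/
theorem coeffVec_diagLimit (a : σ → ℤ) (p : MvPolynomial σ k) :
    coeffVec (diagLimit a p) = fun d => if diagWeight a d = 0 then coeff d p else 0 := by
  funext d
  rw [coeffVec_apply, coeff_diagLimit]

end LimitField

/-! ### Diagonal substitutions act on monomials by characters -/

section Diagonal

variable {σ : Type*} [Fintype σ] [DecidableEq σ] {k : Type*} [CommRing k]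

/-- A diagonal substitution `x_i ↦ β_i x_i` multiplies the monomial `c x^e` by `∏_i β_i^{e_i}`
(any commutative ring of coefficients). [cite: BurgisserIkenmeyer2017, §2.2 (proof of Prop. 2.8)] -/
theorem linSubst_diagonal_monomial' (β : σ → k) (e : σ →₀ ℕ) (c : k) :
    linSubst σ k (Matrix.diagonal β) (monomial e c) = (∏ i, β i ^ e i) • monomial e c := by
  have hX : ∀ i, linSubst σ k (Matrix.diagonal β) (X i) = C (β i) * X i := by
    intro i
    rw [linSubst_X, Finset.sum_eq_single i (fun j _ hj => by
      rw [Matrix.diagonal_apply_ne _ hj, zero_smul]) (fun h => absurd (Finset.mem_univ i) h),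
      Matrix.diagonal_apply_eq, smul_eq_C_mul]
  rw [monomial_eq, map_mul, linSubst_C, Finsupp.prod_fintype _ _ (fun i => pow_zero _), map_prod]
  simp only [map_pow, hX, mul_pow, Finset.prod_mul_distrib]
  rw [smul_eq_C_mul, map_prod]
  simp only [map_pow]
  ring

/-- **Coefficients of a diagonally substituted polynomial**: `coeff_d (diag(β)·p) = β^d · coeff_d p`
(GIT Ch. 2 §1, `(*)'`: the `i`-th coordinate is multiplied by the `i`-th character).
[cite: MumfordFogartyKirwan1994, Ch. 2 §1 (proof of Thm. 2.1, eq. (*)')] -/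
theorem coeff_linSubst_diagonal_eq_prod_mul (β : σ → k) (p : MvPolynomial σ k) (d : σ →₀ ℕ) :
    coeff d (linSubst σ k (Matrix.diagonal β) p) = (∏ i, β i ^ d i) * coeff d p := by
  conv_lhs => rw [p.as_sum]
  rw [map_sum, coeff_sum]
  simp_rw [linSubst_diagonal_monomial', coeff_smul, coeff_monomial, smul_eq_mul]
  rw [Finset.sum_eq_single d]
  · rw [if_pos rfl]
  · intro e _ he
    rw [if_neg he, mul_zero]
  · intro hd
    rw [MvPolynomial.notMem_support_iff.mp hd, if_pos rfl, mul_zero]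

/-- The support does not grow under a diagonal substitution. [cite: MumfordFogartyKirwan1994, Ch. 2 §1 (proof of Thm. 2.1)] -/
theorem support_linSubst_diagonal_subset (β : σ → k) (p : MvPolynomial σ k) :
    (linSubst σ k (Matrix.diagonal β) p).support ⊆ p.support := by
  intro d hd
  rw [mem_support_iff, coeff_linSubst_diagonal_eq_prod_mul] at hd
  rw [mem_support_iff]
  intro h
  exact hd (by rw [h, mul_zero])

end Diagonal

section DiagonalField

variable {σ : Type*} [Fintype σ] [DecidableEq σ] {k : Type*} [Field k]

/-- `∏_i t^{f_i} = t^{∑ f_i}` in a commutative group. [folklore] -/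
private theorem prod_zpow_eq_zpow_sum' {G : Type*} [CommGroup G] {ι : Type*} (t : G) (s : Finset ι)
    (f : ι → ℤ) : ∏ i ∈ s, t ^ f i = t ^ ∑ i ∈ s, f i := by
  classical
  induction s using Finset.induction_on with
  | empty => simp
  | insert i s hi ih => rw [Finset.prod_insert hi, Finset.sum_insert hi, zpow_add, ih]

omit [DecidableEq σ] in
/-- The character of `diag(t^a)` on `x^d` is `t^{⟨a,d⟩}`: `∏_i (t^{a_i})^{d_i} = t^{⟨a,d⟩}` in `kˣ`.
[cite: MumfordFogartyKirwan1994, Ch. 2 §1 (proof of Thm. 2.1)] -/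
theorem prod_units_zpow_pow (t : kˣ) (a : σ → ℤ) (d : σ →₀ ℕ) :
    (∏ i, ((t ^ a i : kˣ) : k) ^ d i) = ((t ^ diagWeight a d : kˣ) : k) := by
  rw [diagWeight, ← prod_zpow_eq_zpow_sum', Units.coe_prod]
  refine Finset.prod_congr rfl fun i _ => ?_
  rw [← Units.val_pow_eq_pow_val, ← zpow_natCast, ← zpow_mul]

/-- **`diag(t^a) · p = ∑_d t^{⟨a,d⟩} p_d x^d`** (GIT Ch. 2 §1 `(*)'`; BI 2017 §2.2).
[cite: MumfordFogartyKirwan1994, Ch. 2 §1 (proof of Thm. 2.1, eq. (*)')]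
[cite: BurgisserIkenmeyer2017, §2.2 (proof of Prop. 2.8)] -/
theorem coeff_linSubst_diagonal_zpow (t : kˣ) (a : σ → ℤ) (p : MvPolynomial σ k) (d : σ →₀ ℕ) :
    coeff d (linSubst σ k (Matrix.diagonal fun i => ((t ^ a i : kˣ) : k)) p) =
      ((t ^ diagWeight a d : kˣ) : k) * coeff d p := by
  rw [coeff_linSubst_diagonal_eq_prod_mul, prod_units_zpow_pow]

/-- `diag(t^a)` lies in `SL_σ` when `∑ a_i = 0`. [cite: MumfordFogartyKirwan1994, Ch. 2 §1] -/
theorem det_diagonal_zpow_eq_one (t : kˣ) {a : σ → ℤ} (ha : ∑ i, a i = 0) :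
    (Matrix.diagonal fun i => ((t ^ a i : kˣ) : k)).det = 1 := by
  rw [Matrix.det_diagonal, ← Units.coe_prod, prod_zpow_eq_zpow_sum', ha, zpow_zero, Units.val_one]

/-- `diag(t^a)` as an element of `SL_σ(k)` when `∑ a_i = 0`. [cite: MumfordFogartyKirwan1994, Ch. 2 §1] -/
theorem exists_sl_coe_eq_diagonal_zpow (t : kˣ) {a : σ → ℤ} (ha : ∑ i, a i = 0) :
    ∃ g : Matrix.SpecialLinearGroup σ k,
      (g : Matrix σ σ k) = Matrix.diagonal fun i => ((t ^ a i : kˣ) : k) :=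
  ⟨⟨_, det_diagonal_zpow_eq_one t ha⟩, rfl⟩

end DiagonalField

/-! ### The algebraic limit lemma: Zariski closed sets are closed under `t → 0` along polynomial curves -/

section Curve

variable {k : Type*} [Field k] [Infinite k] {ι : Type*}

/-- **Zariski closed sets contain the limits of their punctured polynomial curves.** Let `S ⊆ k^ι`
be Zariski closed (`Z(I(S)) ⊆ S`), `k` infinite. If the points `(y_i t^{e_i})_i` lie in `S` for all
`t ≠ 0`, then so does the point at `t = 0`, namely `(y_i · [e_i = 0])_i`: a polynomial vanishing on
`S` pulls back to a polynomial in `t` with infinitely many roots, hence zero, hence vanishing at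
`t = 0`. (GIT Ch. 2 §1: "`σ(λ(α), x)` has a specialization when `α → 0`", made algebraic.)
[cite: MumfordFogartyKirwan1994, Ch. 2 §1 (p. 56, the morphism `ψ_x ∘ λ` extended to `𝔸¹`)] -/
theorem mem_of_forall_ne_zero_mul_pow_mem {S : Set (ι → k)} (hS : zariskiClosure S ⊆ S)
    (y : ι → k) (e : ι → ℕ) (h : ∀ t : k, t ≠ 0 → (fun i => y i * t ^ e i) ∈ S) :
    (fun i => if e i = 0 then y i else 0) ∈ S := by
  classical
  apply hS
  rw [mem_zariskiClosure_iff]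
  intro p hp
  -- pull `p` back along the curve: a polynomial in one variable `T`
  set c : ι → Polynomial k := fun i => Polynomial.C (y i) * Polynomial.X ^ e i with hc
  set Q : Polynomial k := aeval c p with hQ
  have hQt : ∀ t : k, Polynomial.eval t Q = aeval (fun i => y i * t ^ e i) p := by
    intro t
    have hfun : (fun i => Polynomial.aeval t (c i)) = fun i => y i * t ^ e i := by
      funext i
      simp [hc]
    rw [hQ, ← Polynomial.coe_aeval_eq_eval, ← AlgHom.comp_apply, comp_aeval, hfun]
  -- `Q` vanishes at every `t ≠ 0`, hence `Q = 0`
  have hQ0 : Q = 0 := by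
    apply Polynomial.eq_zero_of_infinite_isRoot
    apply Set.Infinite.mono (s := {t : k | t ≠ 0})
    · intro t ht
      rw [Set.mem_setOf_eq, Polynomial.IsRoot.def, hQt]
      exact (mem_zariskiClosure_iff.mp (subset_zariskiClosure S (h t ht))) p hp
    · exact (Set.finite_singleton (0 : k)).infinite_compl
  -- evaluate at `t = 0`
  have h0 := hQt 0
  rw [hQ0, Polynomial.eval_zero] at h0
  have hfun : (fun i => y i * (0 : k) ^ e i) = fun i => if e i = 0 then y i else 0 := by
    funext i
    split_ifs with hi
    · rw [hi, pow_zero, mul_one]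
    · rw [zero_pow hi, mul_zero]
  rw [← hfun]
  exact h0.symm

end Curve

/-! ### Zariski closed sets of polynomials stable under diagonal `SL` contain the limits -/

section LimitMem

variable {σ : Type*} [Fintype σ] [DecidableEq σ] {k : Type*} [Field k] [Infinite k]

/-- **`lim_{t→0} diag(t^a) · p` lies in every Zariski closed set containing the curve.** If every
monomial of `p` has weight `⟨a,d⟩ ≥ 0` and the coefficient vectors of `diag(t^a) · p`, `t ∈ kˣ`, lie
in a Zariski closed subset `S` of coefficient space, then so does the coefficient vector of the
limit `diagLimit a p` (GIT Ch. 2 §1; Kempf 1978 §1: "`lim_{t→0} λ(t) x` exists").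
[cite: MumfordFogartyKirwan1994, Ch. 2 §1 (proof of Thm. 2.1)] [cite: Kempf1978, §1] -/
theorem coeffVec_diagLimit_mem {S : Set ((σ →₀ ℕ) → k)} (hS : zariskiClosure S ⊆ S)
    (a : σ → ℤ) (p : MvPolynomial σ k) (hsupp : ∀ d ∈ p.support, 0 ≤ diagWeight a d)
    (hmem : ∀ t : kˣ, coeffVec (linSubst σ k (Matrix.diagonal fun i => ((t ^ a i : kˣ) : k)) p) ∈ S) :
    coeffVec (diagLimit a p) ∈ S := by
  -- the curve `t ↦ (coeff_d p · t^{⟨a,d⟩})_d`, exponents made natural numbers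
  set e : (σ →₀ ℕ) → ℕ := fun d => (diagWeight a d).toNat with he
  have hcurve : ∀ t : k, t ≠ 0 → (fun d => coeff d p * t ^ e d) ∈ S := by
    intro t ht
    have hfun : (fun d => coeff d p * t ^ e d) =
        coeffVec (linSubst σ k (Matrix.diagonal fun i => (((Units.mk0 t ht) ^ a i : kˣ) : k)) p) := by
      funext d
      rw [coeffVec_apply, coeff_linSubst_diagonal_zpow, mul_comm]
      by_cases hd : d ∈ p.support
      · congr 1
        have h0 := hsupp d hd
        have he' : ((e d : ℕ) : ℤ) = diagWeight a d := by rw [he]; exact Int.toNat_of_nonneg h0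
        rw [← zpow_natCast, he', Units.val_zpow_eq_zpow_val, Units.val_mk0]
      · simp [MvPolynomial.notMem_support_iff.mp hd]
    rw [hfun]
    exact hmem _
  have hlim := mem_of_forall_ne_zero_mul_pow_mem hS (fun d => coeff d p) e hcurve
  have hfun : (fun d => if e d = 0 then coeff d p else 0) = coeffVec (diagLimit a p) := by
    funext d
    rw [coeffVec_apply, coeff_diagLimit]
    by_cases hd : d ∈ p.support
    · have h0 := hsupp d hd
      have he' : ((e d : ℕ) : ℤ) = diagWeight a d := by rw [he]; exact Int.toNat_of_nonneg h0
      have hiff : e d = 0 ↔ diagWeight a d = 0 := by omega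
      simp only [hiff]
    · rw [MvPolynomial.notMem_support_iff.mp hd]
      simp
  rwa [hfun] at hlim

/-- **The limit along a diagonal one-parameter subgroup of `SL` stays in any `SL`-stable Zariski
closed set**: if `∑ a = 0`, `S` is Zariski closed and stable under `SL_σ(k)`, `coeffVec p ∈ S` and
all monomials of `p` have weight `≥ 0`, then `coeffVec (diagLimit a p) ∈ S`.
[cite: MumfordFogartyKirwan1994, Ch. 2 §1 (proof of Thm. 2.1)] [cite: Kempf1978, §1] -/
theorem coeffVec_diagLimit_mem_of_slStable {S : Set ((σ →₀ ℕ) → k)} (hS : zariskiClosure S ⊆ S)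
    (hstab : ∀ (g : Matrix.SpecialLinearGroup σ k) (q : MvPolynomial σ k),
      coeffVec q ∈ S → coeffVec (linSubst σ k (g : Matrix σ σ k) q) ∈ S)
    {a : σ → ℤ} (ha : ∑ i, a i = 0) {p : MvPolynomial σ k} (hp : coeffVec p ∈ S)
    (hsupp : ∀ d ∈ p.support, 0 ≤ diagWeight a d) :
    coeffVec (diagLimit a p) ∈ S := by
  refine coeffVec_diagLimit_mem hS a p hsupp fun t => ?_
  obtain ⟨g, hg⟩ := exists_sl_coe_eq_diagonal_zpow t ha
  rw [← hg]
  exact hstab g p hp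

/-- **The limit lies in the closure of the `SL`-orbit**: for `∑ a = 0` and a polynomial `p` whose
monomials all have weight `≥ 0`, the coefficient vector of `lim_{t→0} diag(t^a)·p` lies in the Zariski
closure of (the coefficient vectors of) `SL·p` — the "if" halves of the Hilbert–Mumford criterion
(GIT Ch. 2 §1: "The two 'if' statements are obvious").
[cite: MumfordFogartyKirwan1994, Ch. 2 §1 (proof of Thm. 2.1, p. 60)] -/
theorem coeffVec_diagLimit_mem_zariskiClosure_slOrbit {a : σ → ℤ} (ha : ∑ i, a i = 0)
    (p : MvPolynomial σ k) (hsupp : ∀ d ∈ p.support, 0 ≤ diagWeight a d) :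
    coeffVec (diagLimit a p) ∈ zariskiClosure (coeffVec '' slOrbit σ k p) := by
  refine coeffVec_diagLimit_mem (S := zariskiClosure (coeffVec '' slOrbit σ k p))
    (by rw [zariskiClosure_zariskiClosure]) a p hsupp fun t => ?_
  obtain ⟨g, hg⟩ := exists_sl_coe_eq_diagonal_zpow t ha
  refine subset_zariskiClosure _ ⟨_, ⟨g, ?_⟩, rfl⟩
  rw [hg]

end LimitMem

end Literature.Computability.AlgebraicComplexity

end
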